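import Mathlib.RingTheory.Spectrum.Prime.FreeLocus
import Mathlib.RingTheory.Ideal.Height
import Mathlib.RingTheory.Ideal.MinimalPrime.Noetherian
import Mathlib.RingTheory.Localization.Algebra
import Mathlib.RingTheory.Localization.AtPrime.Basic
import Mathlib.LinearAlgebra.FreeModule.PID
import Mathlib.RingTheory.PrincipalIdealDomain
import HarnessLib

/-!
# Route `RadicialJung`, crux `CleanModels` (stmt-15917): the NON-PRINCIPAL LOCUS of a nonzero ideal on a
# noetherian domain of dimension ≤ 2, regular in codimension one, is a finite set of maximal ideals —
# brick B3 / FILE 3 (step (S3) of `L/res-L1-s42-pv-2/w81-B3/B3-PLAN.md`) of T2-ARCHITECTURE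

Support file (OURS) for PROGRAMME-clean-dim2 / T2 (`HOME/L/res-L0-w81-pv-2/g5/T2-ARCHITECTURE.md`, brick **B3**
«finiteness of the Giraud-singular points»; seat res-L1-s42-pv-2 g7, res-plan-2 IDLE POOL DEAL #50 (2)), line
`via-clean-models` of the crux `DescentPerfectToAll` (stmt-0549).  Nothing here is a statement of Hironaka's
manuscript.  AI-written; AI review weaker than expert review.  Pure commutative algebra over Mathlib.

By FILE 1 (`…GiraudCoprincipalPart`, p559369) Giraud's colength `c(X, f, ξ)` vanishes as soon as the log-Jacobian
ideal is PRINCIPAL at `ξ`; so the finiteness of the Giraud-singular set (B3) is the finiteness, on each affine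
chart, of the set of closed points at which a fixed nonzero coherent ideal is not principal.  This file proves that
finiteness in the language of Mathlib's free locus:

* `Ideal.isPrincipal_of_free` — a FREE ideal of a domain is principal (two elements of an ideal are always
  linearly dependent, so a basis has at most one element).
* `mem_freeLocus_iff_free_map` — `𝔭 ∈ freeLocus A J` iff the extended ideal `J·A_𝔭` is a free `A_𝔭`-module
  (Mathlib's `mem_freeLocus_of_isLocalization` with `Algebra.idealMap`); hence `isPrincipal_map_of_mem_freeLocus`.
* `bot_mem_freeLocus` (the generic point: `A_(0)` is the fraction field), `mem_freeLocus_of_isPrincipalIdealRing`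
  (a point whose local ring is a principal ideal domain, e.g. a height-one point of a scheme regular in codimension
  one: torsion-free finitely generated ⇒ free).
* **`finite_compl_freeLocus`**: `A` a noetherian domain with `ringKrullDim A ≤ 2` whose height-one local rings are
  principal ideal rings, `J` an ideal ⇒ `(freeLocus A J)ᶜ` is FINITE and consists of maximal ideals (it is closed —
  `Module.isOpen_freeLocus` —, misses the generic point and the height-one points, so each of its points is a
  height-two = maximal prime, minimal over the ideal cutting the closed set out; `Ideal.finite_minimalPrimes_of_isNoetherianRing`).
* **`finite_setOf_not_isPrincipal_map_atPrime`**: the set of primes `𝔭` with `J·A_𝔭` not principal is finite.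
-/

set_option linter.dupNamespace false -- mandated namespace of this single-conjunct summit

open Module PrimeSpectrum IsLocalRing

namespace Summit.ResolutionOfSingularities.ResolutionOfSingularities.Theorems.RadicialJung.CleanModels

universe u

/-! ## A free ideal of a domain is principal -/

/-- **A free ideal of a domain is principal**: any two elements `a, b` of an ideal satisfy `b·a − a·b = 0`, so a
basis of the ideal has at most one element. -/
theorem _root_.Ideal.isPrincipal_of_free {R : Type u} [CommRing R] [IsDomain R] (I : Ideal R) [Module.Free R I] :
    I.IsPrincipal := by
  classical
  let b := Module.Free.chooseBasis R I
  by_cases hι : IsEmpty (Module.Free.ChooseBasisIndex R I)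
  · -- no basis vector: `I = ⊥`
    haveI : Subsingleton I := b.repr.toEquiv.subsingleton_congr.mpr inferInstance
    refine ⟨0, ?_⟩
    ext x
    simp only [Submodule.mem_span_singleton, smul_zero, exists_const]
    constructor
    · intro hx
      have := Subsingleton.elim (⟨x, hx⟩ : I) 0
      exact (congrArg Subtype.val this).symm
    · rintro rfl; exact I.zero_mem
  · rw [not_isEmpty_iff] at hι
    obtain ⟨i⟩ := hι
    -- all basis indices coincide with `i`
    have hall : ∀ j, j = i := by
      intro j
      by_contra hji
      have hli := b.linearIndependent
      rw [linearIndependent_iff'] at hli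
      have hrel : ∑ k ∈ ({i, j} : Finset _), (fun k => if k = i then ((b j : I) : R) else -((b i : I) : R)) k • b k = 0 := by
        rw [Finset.sum_pair (Ne.symm hji)]
        simp only [if_true, if_neg hji]
        apply Subtype.ext
        simp only [Submodule.coe_add, Submodule.coe_smul_of_tower, smul_eq_mul, neg_mul,
          Submodule.coe_zero]
        ring
      have h0 := hli {i, j} _ hrel i (Finset.mem_insert_self _ _)
      simp only [if_true] at h0
      have hbj : (b j : I) ≠ 0 := b.ne_zero j
      exact hbj (Subtype.ext h0)
    refine ⟨((b i : I) : R), ?_⟩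
    apply le_antisymm
    · intro x hx
      have hmem : (⟨x, hx⟩ : I) ∈ Submodule.span R (Set.range b) := by rw [b.span_eq]; trivial
      have hrange : Set.range b = {b i} := by
        ext v; constructor
        · rintro ⟨j, rfl⟩; rw [hall j]; rfl
        · rintro rfl; exact ⟨i, rfl⟩
      rw [hrange, Submodule.mem_span_singleton] at hmem
      obtain ⟨r, hr⟩ := hmem
      rw [Ideal.submodule_span_eq, Ideal.mem_span_singleton']
      exact ⟨r, by simpa [smul_eq_mul] using congrArg Subtype.val hr⟩
    · rw [Ideal.submodule_span_eq, Ideal.span_singleton_le_iff_mem]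
      exact (b i).2

/-! ## The free locus of an ideal, read on the extended ideals `J·A_𝔭` -/

section FreeLocus

variable {A : Type u} [CommRing A] (J : Ideal A)

/-- `𝔭 ∈ freeLocus A J` iff the extended ideal `J·A_𝔭` is free over `A_𝔭`. -/
theorem mem_freeLocus_iff_free_map (p : PrimeSpectrum A) :
    p ∈ Module.freeLocus A J ↔
      Module.Free (Localization.AtPrime p.asIdeal) (J.map (algebraMap A (Localization.AtPrime p.asIdeal))) :=
  Module.mem_freeLocus_of_isLocalization p (Localization.AtPrime p.asIdeal)
    (J.map (algebraMap A (Localization.AtPrime p.asIdeal))) (Algebra.idealMap _ J)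

/-- **On the free locus the extended ideal is principal** (domain case). -/
theorem isPrincipal_map_of_mem_freeLocus [IsDomain A] {p : PrimeSpectrum A} (hp : p ∈ Module.freeLocus A J) :
    (J.map (algebraMap A (Localization.AtPrime p.asIdeal))).IsPrincipal := by
  haveI := (mem_freeLocus_iff_free_map J p).mp hp
  exact Ideal.isPrincipal_of_free _

/-- **The generic point is in the free locus** (domain: `A_(0)` is the fraction field, over which every module is free). -/
theorem bot_mem_freeLocus [IsDomain A] : (⟨⊥, Ideal.isPrime_bot⟩ : PrimeSpectrum A) ∈ Module.freeLocus A J := by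
  rw [mem_freeLocus_iff_free_map]
  have : IsFractionRing A (Localization.AtPrime (⊥ : Ideal A)) := by
    simpa [Ideal.primeCompl_bot] using Localization.isLocalization (M := (⊥ : Ideal A).primeCompl)
  letI : Field (Localization.AtPrime (⊥ : Ideal A)) := IsFractionRing.toField A
  exact Module.Free.of_divisionRing _ _

/-- **A point whose local ring is a principal ideal ring is in the free locus** (domain, noetherian: the extended
ideal is a finitely generated torsion-free module over a principal ideal domain, hence free) — e.g. every
height-one point of a noetherian domain regular in codimension one. -/
theorem mem_freeLocus_of_isPrincipalIdealRing [IsDomain A] [IsNoetherianRing A] (p : PrimeSpectrum A)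
    [IsPrincipalIdealRing (Localization.AtPrime p.asIdeal)] : p ∈ Module.freeLocus A J := by
  rw [mem_freeLocus_iff_free_map]
  haveI : IsNoetherianRing (Localization.AtPrime p.asIdeal) :=
    IsLocalization.isNoetherianRing p.asIdeal.primeCompl _ inferInstance
  exact Module.free_of_finite_type_torsion_free'

end FreeLocus

/-! ## Finiteness of the non-free / non-principal locus in dimension two -/

section DimTwo

variable {A : Type u} [CommRing A] [IsDomain A] [IsNoetherianRing A]

omit [IsDomain A] [IsNoetherianRing A] in
/-- In a ring of Krull dimension `≤ 2`, **a prime of height neither `0` nor `1` is maximal**. -/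
theorem isMaximal_of_height_ne (hdim : ringKrullDim A ≤ 2) {P : Ideal A} [P.IsPrime] (h0 : P.height ≠ 0)
    (h1 : P.height ≠ 1) : P.IsMaximal := by
  have hle : P.height ≤ 2 := by
    have h' := Ideal.height_le_ringKrullDim_of_isPrime (I := P)
    exact WithBot.coe_le_coe.mp (h'.trans hdim)
  have h2 : P.height = 2 := by
    generalize P.height = x at h0 h1 hle
    induction x using ENat.recTopCoe with
    | top => exact absurd hle (by decide)
    | coe n =>
      have : n ≤ 2 := by exact_mod_cast hle
      have h0' : n ≠ 0 := fun h => h0 (by simp [h])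
      have h1' : n ≠ 1 := fun h => h1 (by simp [h])
      exact_mod_cast (show n = 2 by omega)
  -- a prime strictly above `P` would have height `> 2`
  obtain ⟨M, hM, hPM⟩ := Ideal.exists_le_maximal P Ideal.IsPrime.ne_top'
  rcases hPM.lt_or_eq with hlt | heq
  · exfalso
    haveI := hM.isPrime
    have hPfin : P.FiniteHeight := P.finiteHeight_iff.mpr (Or.inr (by rw [h2]; decide))
    have hlt' := Ideal.height_strict_mono_of_isPrime hlt
    have hMle : M.height ≤ 2 := by
      have h' := Ideal.height_le_ringKrullDim_of_isPrime (I := M)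
      exact WithBot.coe_le_coe.mp (h'.trans hdim)
    rw [h2] at hlt'
    exact absurd (lt_of_lt_of_le hlt' hMle) (lt_irrefl _)
  · rwa [heq]

/-- **The complement of the free locus is a finite set of maximal ideals** for an ideal `J` of a noetherian domain
of dimension `≤ 2` all of whose height-one primes are in the free locus (regular in codimension one). -/
theorem finite_compl_freeLocus (hdim : ringKrullDim A ≤ 2) (J : Ideal A)
    (h1 : ∀ p : PrimeSpectrum A, p.asIdeal.height = 1 → p ∈ Module.freeLocus A J) :
    (Module.freeLocus A J)ᶜ.Finite ∧ ∀ p ∈ (Module.freeLocus A J)ᶜ, p.asIdeal.IsMaximal := by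
  haveI : Module.FinitePresentation A J := Module.finitePresentation_of_finite A J
  -- every point off the free locus is maximal
  have hmax : ∀ p ∈ (Module.freeLocus A J)ᶜ, p.asIdeal.IsMaximal := by
    intro p hp
    refine isMaximal_of_height_ne hdim (fun h0 => ?_) (fun h1' => hp (h1 p h1'))
    have hbot : p.asIdeal = ⊥ := Ideal.height_eq_zero_iff_eq_bot.mp h0
    apply hp
    have : p = ⟨⊥, Ideal.isPrime_bot⟩ := PrimeSpectrum.ext hbot
    rw [this]
    exact bot_mem_freeLocus J
  refine ⟨?_, hmax⟩
  -- the complement is closed: the zero locus of some ideal `I`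
  have hclosed : IsClosed (Module.freeLocus A J)ᶜ := Module.isOpen_freeLocus.isClosed_compl
  obtain ⟨I, hI⟩ := (PrimeSpectrum.isClosed_iff_zeroLocus_ideal _).mp hclosed
  -- every point of the complement is a minimal prime of `I`
  have hsub : (Module.freeLocus A J)ᶜ ⊆ (fun P : I.minimalPrimes => (⟨P.1, P.2.1.1⟩ : PrimeSpectrum A)) '' Set.univ := by
    intro p hp
    have hpI : I ≤ p.asIdeal := by
      have : p ∈ PrimeSpectrum.zeroLocus (I : Set A) := hI ▸ hp
      exact this
    obtain ⟨q, hqmin, hqp⟩ := Ideal.exists_minimalPrimes_le hpI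
    haveI : q.IsPrime := hqmin.1.1
    have hq_mem : (⟨q, hqmin.1.1⟩ : PrimeSpectrum A) ∈ (Module.freeLocus A J)ᶜ := by
      rw [hI]; exact hqmin.1.2
    have hqmax := hmax _ hq_mem
    have hqeq : q = p.asIdeal := (hqmax.eq_of_le p.isPrime.ne_top hqp)
    refine ⟨⟨q, hqmin⟩, Set.mem_univ _, PrimeSpectrum.ext hqeq⟩
  haveI : Finite I.minimalPrimes := (Ideal.finite_minimalPrimes_of_isNoetherianRing A I).to_subtype
  exact ((Set.finite_univ.image _).subset hsub)

/-- **Finiteness of the non-principal locus**: for an ideal `J` of a noetherian domain of dimension `≤ 2` whose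
height-one primes are in the free locus, the set of primes `𝔭` at which `J·A_𝔭` is not principal is finite (and
consists of maximal ideals). -/
theorem finite_setOf_not_isPrincipal_map_atPrime (hdim : ringKrullDim A ≤ 2) (J : Ideal A)
    (h1 : ∀ p : PrimeSpectrum A, p.asIdeal.height = 1 → p ∈ Module.freeLocus A J) :
    {p : PrimeSpectrum A | ¬ (J.map (algebraMap A (Localization.AtPrime p.asIdeal))).IsPrincipal}.Finite := by
  refine (finite_compl_freeLocus hdim J h1).1.subset fun p hp hmem => hp ?_
  exact isPrincipal_map_of_mem_freeLocus J hmem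

/-- The same with the codimension-one hypothesis in the form «every height-one local ring is a principal ideal
ring» (e.g. a discrete valuation ring: regularity in codimension one). -/
theorem finite_setOf_not_isPrincipal_map_atPrime_of_isPrincipalIdealRing (hdim : ringKrullDim A ≤ 2) (J : Ideal A)
    (h1 : ∀ p : PrimeSpectrum A, p.asIdeal.height = 1 → IsPrincipalIdealRing (Localization.AtPrime p.asIdeal)) :
    {p : PrimeSpectrum A | ¬ (J.map (algebraMap A (Localization.AtPrime p.asIdeal))).IsPrincipal}.Finite :=
  finite_setOf_not_isPrincipal_map_atPrime hdim J fun p hp => by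
    haveI := h1 p hp
    exact mem_freeLocus_of_isPrincipalIdealRing J p

end DimTwo

end Summit.ResolutionOfSingularities.ResolutionOfSingularities.Theorems.RadicialJung.CleanModels
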